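import Summits.BirchSwinnertonDyer.BirchSwinnertonDyer.Theorems.EisensteinPrimesPadicPiPrimeToP
import Mathlib.GroupTheory.Perm.Cycle.Type
import Mathlib.NumberTheory.Padics.ProperSpace
import HarnessLib

/-!
# Route `EisensteinPrimes` (rung K5), crux 2 `GoodLatticeBDPValue`, line `halves` v8, stub
# `stub_locallyTrivialOverTower`, brick F5(iii-b): THE JOINT KERNEL OF CONTINUOUS HOMOMORPHISMS
# `∏_ℓ ℤ_ℓ → ℤ_p` IS THE PRIME-TO-`p` PART, AND ITS OPEN SUBGROUPS HAVE INDEX PRIME TO `p`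
# (helper for stmt-BirchSwinnertonDyer-19032)

Cell `bsd-eis`, seat `bsd-eis-k5-c2` (gen 9). For `Ẑ = ∏_ℓ ℤ_ℓ` (Mathlib `∀ q : Nat.Primes, ℤ_q`) and
two continuous additive maps `χ₁, χ₂ : ∏_ℓ ℤ_ℓ → ℤ_p` not both zero (the descended characters
`κ̄₁, κ̄₂` of the `ℤ_p²`-tower on `Gal(K_w^nr/K_w) ≅ Ẑ` at a place `w ∤ p` which does not split
completely in `K̃_∞`):
* `mem_ker_inf_ker_iff_apply_eq_zero` — the joint kernel `Q = ker χ₁ ⊓ ker χ₂` is EXACTLY the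
  prime-to-`p` part `{x : x_p = 0}` (`⊇`: p547817 `apply_eq_zero_of_apply_prime_eq_zero`; `⊆`: the
  `p`-coordinate map `t ↦ χᵢ(single_p t)` is a non-zero, hence injective, continuous endomorphism of `ℤ_p`);
* **`coprime_index_of_isOpen_of_le_ker`** — every subgroup `V` whose trace on `Q` is open in `Q` has index `[Q : V ⊓ Q]`
  PRIME TO `p`: some `m` prime to `p` multiplies `Q` into `V` (p547817
  `exists_nsmul_mem_of_isOpen_padicPi` applied to the pull-back of `V` under the projection onto the
  prime-to-`p` part), and Cauchy's theorem.
This is hypothesis (★) of the pro-`p′` vanishing lemma (p547081) for `Gal(K̄_w/K̃_{∞,η}) ⊇ I_w`,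
`w ∤ p`, once transported along `Γ_{K_w} ⧸ I_{K_w} ≅ Ẑ` (`isFreeProcyclic_quotient_galUnr`,
`isFreeProcyclic_iff_nonempty_continuousMulEquiv_padicProd`) — brick F5(ii)/(iv). Theorems only; no
definition, no named fact, no instance, no `sorry`. HONEST FRAMING: closes nothing by itself.
References: [SerreGaloisCohomology1997] I §1.1–1.4; [RibesZalesskii2010] Thm. 2.7.2.
-/

set_option autoImplicit false
set_option linter.dupNamespace false

noncomputable section

open scoped Classical

namespace Summit.BirchSwinnertonDyer.BirchSwinnertonDyer.Theorems.GreenbergFullAtSelmer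

variable (p₀ : Nat.Primes)
  (χ₁ χ₂ : (∀ q : Nat.Primes, @PadicInt (q : ℕ) ⟨q.2⟩) →+ @PadicInt (p₀ : ℕ) ⟨p₀.2⟩)

/-- The `p`-coordinate embedding `single_p : ℤ_p → ∏_ℓ ℤ_ℓ` is continuous. [folklore] -/
theorem continuous_single_padicPi :
    Continuous (AddMonoidHom.single (fun q : Nat.Primes ↦ @PadicInt (q : ℕ) ⟨q.2⟩) p₀) := by
  change Continuous fun t : @PadicInt (p₀ : ℕ) ⟨p₀.2⟩ ↦
    (Pi.single p₀ t : ∀ q : Nat.Primes, @PadicInt (q : ℕ) ⟨q.2⟩)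
  exact continuous_single (A := fun q : Nat.Primes ↦ @PadicInt (q : ℕ) ⟨q.2⟩) p₀

/-- Splitting off the `p`-coordinate: `x = single_p (x_p) + x'` with `x'_p = 0`. [folklore] -/
theorem sub_single_apply_self (x : ∀ q : Nat.Primes, @PadicInt (q : ℕ) ⟨q.2⟩) :
    (x - (Pi.single p₀ (x p₀) : ∀ q : Nat.Primes, @PadicInt (q : ℕ) ⟨q.2⟩)) p₀ = 0 := by
  simp

/-- A continuous additive map `χ : ∏_ℓ ℤ_ℓ → ℤ_p` is its `p`-coordinate map after the `p`-coordinate: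
`χ x = χ (single_p (x_p))`. [cite: SerreGaloisCohomology1997, I §1.4] -/
theorem apply_eq_apply_single (χ : (∀ q : Nat.Primes, @PadicInt (q : ℕ) ⟨q.2⟩) →+ @PadicInt (p₀ : ℕ) ⟨p₀.2⟩)
    (hχ : Continuous χ) (x : ∀ q : Nat.Primes, @PadicInt (q : ℕ) ⟨q.2⟩) :
    χ x = χ (Pi.single p₀ (x p₀) : ∀ q : Nat.Primes, @PadicInt (q : ℕ) ⟨q.2⟩) := by
  have h := apply_eq_zero_of_apply_prime_eq_zero p₀ χ hχ
    (x - (Pi.single p₀ (x p₀) : ∀ q : Nat.Primes, @PadicInt (q : ℕ) ⟨q.2⟩))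
    (sub_single_apply_self p₀ x)
  rwa [map_sub, sub_eq_zero] at h

/-- **The joint kernel of `χ₁, χ₂` (not both zero) is exactly the prime-to-`p` part `{x : x_p = 0}`.**
[cite: SerreGaloisCohomology1997, I §1.4] -/
theorem mem_ker_inf_ker_iff_apply_eq_zero (hχ₁ : Continuous χ₁) (hχ₂ : Continuous χ₂)
    (hne : ∃ y, χ₁ y ≠ 0 ∨ χ₂ y ≠ 0) (x : ∀ q : Nat.Primes, @PadicInt (q : ℕ) ⟨q.2⟩) :
    x ∈ χ₁.ker ⊓ χ₂.ker ↔ x p₀ = 0 := by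
  haveI : Fact (p₀ : ℕ).Prime := ⟨p₀.2⟩
  constructor
  · intro hx
    have h₁ : χ₁ x = 0 := (AddMonoidHom.mem_ker).mp (AddSubgroup.mem_inf.mp hx).1
    have h₂ : χ₂ x = 0 := (AddMonoidHom.mem_ker).mp (AddSubgroup.mem_inf.mp hx).2
    rw [apply_eq_apply_single p₀ χ₁ hχ₁] at h₁
    rw [apply_eq_apply_single p₀ χ₂ hχ₂] at h₂
    obtain ⟨y, hy⟩ := hne
    -- the non-zero `p`-coordinate map is injective
    let φ₁ : @PadicInt (p₀ : ℕ) ⟨p₀.2⟩ →+ @PadicInt (p₀ : ℕ) ⟨p₀.2⟩ :=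
      χ₁.comp (AddMonoidHom.single (fun q : Nat.Primes ↦ @PadicInt (q : ℕ) ⟨q.2⟩) p₀)
    let φ₂ : @PadicInt (p₀ : ℕ) ⟨p₀.2⟩ →+ @PadicInt (p₀ : ℕ) ⟨p₀.2⟩ :=
      χ₂.comp (AddMonoidHom.single (fun q : Nat.Primes ↦ @PadicInt (q : ℕ) ⟨q.2⟩) p₀)
    have hφ₁c : Continuous φ₁ := hχ₁.comp (continuous_single_padicPi p₀)
    have hφ₂c : Continuous φ₂ := hχ₂.comp (continuous_single_padicPi p₀)
    have hφ₁ : ∀ t, φ₁ t = χ₁ (Pi.single p₀ t : ∀ q : Nat.Primes, @PadicInt (q : ℕ) ⟨q.2⟩) :=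
      fun t ↦ rfl
    have hφ₂ : ∀ t, φ₂ t = χ₂ (Pi.single p₀ t : ∀ q : Nat.Primes, @PadicInt (q : ℕ) ⟨q.2⟩) :=
      fun t ↦ rfl
    rcases hy with hy | hy
    · have hne₁ : φ₁ ≠ 0 := fun h0 ↦ hy (by
        rw [apply_eq_apply_single p₀ χ₁ hχ₁ y, ← hφ₁, h0, AddMonoidHom.zero_apply])
      have hinj := PadicInt.injective_of_continuous_of_ne_zero φ₁ hφ₁c hne₁
      exact hinj (by rw [hφ₁, map_zero]; exact h₁)
    · have hne₂ : φ₂ ≠ 0 := fun h0 ↦ hy (by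
        rw [apply_eq_apply_single p₀ χ₂ hχ₂ y, ← hφ₂, h0, AddMonoidHom.zero_apply])
      have hinj := PadicInt.injective_of_continuous_of_ne_zero φ₂ hφ₂c hne₂
      exact hinj (by rw [hφ₂, map_zero]; exact h₂)
  · intro hx
    exact AddSubgroup.mem_inf.mpr
      ⟨(AddMonoidHom.mem_ker).mpr (apply_eq_zero_of_apply_prime_eq_zero p₀ χ₁ hχ₁ x hx),
        (AddMonoidHom.mem_ker).mpr (apply_eq_zero_of_apply_prime_eq_zero p₀ χ₂ hχ₂ x hx)⟩

/-- **Every subgroup of the joint kernel `Q = ker χ₁ ⊓ ker χ₂` which is open in `Q` has index prime to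
`p`** (`χ₁, χ₂` continuous, not both zero): `Q = {x_p = 0}` is the prime-to-`p` part of `Ẑ`.
[cite: SerreGaloisCohomology1997, I §1.4] [cite: RibesZalesskii2010, Thm. 2.7.2] -/
theorem coprime_index_of_isOpen_of_le_ker (hχ₁ : Continuous χ₁) (hχ₂ : Continuous χ₂)
    (hne : ∃ y, χ₁ y ≠ 0 ∨ χ₂ y ≠ 0)
    (V : AddSubgroup (∀ q : Nat.Primes, @PadicInt (q : ℕ) ⟨q.2⟩))
    (hVopen : IsOpen (((↑) : ↥(χ₁.ker ⊓ χ₂.ker) → (∀ q : Nat.Primes, @PadicInt (q : ℕ) ⟨q.2⟩)) ⁻¹'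
      (V : Set (∀ q : Nat.Primes, @PadicInt (q : ℕ) ⟨q.2⟩)))) :
    Nat.Coprime (p₀ : ℕ) (V.addSubgroupOf (χ₁.ker ⊓ χ₂.ker)).index := by
  haveI : Fact (p₀ : ℕ).Prime := ⟨p₀.2⟩
  set K : AddSubgroup (∀ q : Nat.Primes, @PadicInt (q : ℕ) ⟨q.2⟩) := χ₁.ker ⊓ χ₂.ker with hK
  have hmemK : ∀ x, x ∈ K ↔ x p₀ = 0 := mem_ker_inf_ker_iff_apply_eq_zero p₀ χ₁ χ₂ hχ₁ hχ₂ hne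
  -- the projection onto the prime-to-`p` part, with values in `K`
  let π : (∀ q : Nat.Primes, @PadicInt (q : ℕ) ⟨q.2⟩) →+ K :=
    { toFun := fun x ↦ ⟨x - (Pi.single p₀ (x p₀) : ∀ q : Nat.Primes, @PadicInt (q : ℕ) ⟨q.2⟩),
        (hmemK _).mpr (sub_single_apply_self p₀ x)⟩
      map_zero' := Subtype.ext (by simp)
      map_add' := fun x y ↦ Subtype.ext (by
        change x + y - (Pi.single p₀ ((x + y) p₀) : ∀ q : Nat.Primes, @PadicInt (q : ℕ) ⟨q.2⟩) =
          (x - (Pi.single p₀ (x p₀) : ∀ q : Nat.Primes, @PadicInt (q : ℕ) ⟨q.2⟩)) +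
            (y - (Pi.single p₀ (y p₀) : ∀ q : Nat.Primes, @PadicInt (q : ℕ) ⟨q.2⟩))
        rw [Pi.add_apply, Pi.single_add]
        abel) }
  have hπc : Continuous π := by
    refine Continuous.subtype_mk ?_ _
    exact continuous_id.sub
      ((continuous_single (A := fun q : Nat.Primes ↦ @PadicInt (q : ℕ) ⟨q.2⟩) p₀).comp
        (continuous_apply p₀))
  have hπid : ∀ x : K, π x = x := fun x ↦ Subtype.ext (by
    change (x : ∀ q : Nat.Primes, @PadicInt (q : ℕ) ⟨q.2⟩) -
        (Pi.single p₀ ((x : ∀ q : Nat.Primes, @PadicInt (q : ℕ) ⟨q.2⟩) p₀) :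
          ∀ q : Nat.Primes, @PadicInt (q : ℕ) ⟨q.2⟩) = x
    rw [(hmemK x.1).mp x.2, Pi.single_zero, sub_zero])
  -- the open subgroup `U = π⁻¹ V` of `Ẑ`
  let U : AddSubgroup (∀ q : Nat.Primes, @PadicInt (q : ℕ) ⟨q.2⟩) := (V.addSubgroupOf K).comap π
  have hUopen : IsOpen (U : Set (∀ q : Nat.Primes, @PadicInt (q : ℕ) ⟨q.2⟩)) := hVopen.preimage hπc
  obtain ⟨k, m, hpm, hm0, hmU⟩ := exists_nsmul_mem_of_isOpen_padicPi U hUopen p₀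
  -- `m • K ⊆ V`
  have hmV : ∀ x : K, m • x ∈ V.addSubgroupOf K := by
    intro x
    have hx0 : (x : ∀ q : Nat.Primes, @PadicInt (q : ℕ) ⟨q.2⟩) p₀ ∈
        Ideal.span {((p₀ : ℕ) : @PadicInt (p₀ : ℕ) ⟨p₀.2⟩) ^ k} := by
      rw [(hmemK x.1).mp x.2]; exact Ideal.zero_mem _
    have h := hmU x hx0
    change π (m • (x : ∀ q : Nat.Primes, @PadicInt (q : ℕ) ⟨q.2⟩)) ∈ V.addSubgroupOf K at h
    rwa [map_nsmul, hπid] at h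
  -- finite index (V is open in the compact K) and Cauchy
  haveI : CompactSpace K := isCompact_iff_compactSpace.mp
    (IsClosed.isCompact (by
      have : (K : Set (∀ q : Nat.Primes, @PadicInt (q : ℕ) ⟨q.2⟩)) =
          (fun x ↦ x p₀) ⁻¹' {0} := by
        ext x; exact hmemK x
      rw [this]
      exact isClosed_singleton.preimage (continuous_apply p₀)))
  haveI : Finite (K ⧸ V.addSubgroupOf K) :=
    AddSubgroup.quotient_finite_of_isOpen _ hVopen
  letI := Fintype.ofFinite (K ⧸ V.addSubgroupOf K)
  rw [Nat.Prime.coprime_iff_not_dvd p₀.2, AddSubgroup.index_eq_card, Nat.card_eq_fintype_card]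
  intro hdvd
  obtain ⟨q, hq⟩ := exists_prime_addOrderOf_dvd_card (p₀ : ℕ) hdvd
  induction q using QuotientAddGroup.induction_on with
  | H x =>
    have hmx : m • (x : K ⧸ V.addSubgroupOf K) = 0 := by
      rw [← QuotientAddGroup.mk_nsmul, QuotientAddGroup.eq_zero_iff]
      exact hmV x
    have hord : addOrderOf (x : K ⧸ V.addSubgroupOf K) ∣ m := addOrderOf_dvd_of_nsmul_eq_zero hmx
    rw [hq] at hord
    exact hpm hord

end Summit.BirchSwinnertonDyer.BirchSwinnertonDyer.Theorems.GreenbergFullAtSelmer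

end
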